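import Summits.QuantumFields.BalabanUV.Beta.EriceFlowEnclosureB12AsPrintedHistoryContagionShiftFlow

/-!
# Beta / EriceFlowEnclosureB12AsPrintedHistoryContagionShiftFlowPicardWitness — ASYMPTOTIC FREEDOM IS CONTAGIOUS, part 18: THE REFERENCE AND THE SMALLNESS OF THE PIN
# ARE LOAD-BEARING (kernel witnesses for parts 12–13).  Part 13's floor-free existence `exists_memFlow_of_reference` ∕ `memFlow_solution_of_reference` replaces node U2's
# floor `b ≤ B` + `C_m γ < b(1 − θ)` by (R) ONE asymptotically free reference solution and (S) smallness of the pin.  Neither can be dropped: (W1) the constant functional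
# `B ≡ −1` has memory profile `(0, θ)` on every box and NO box solution from ANY pin (`1∕h(m)² = 1∕e² − m`), so the binder list of part 13 with (R) deleted is FALSE;
# (W2) the Markov functional `B u = 1 − 2·clamp(20(u₀ − ½))` (`clamp = max (min · 1) 0`; β ≡ 1 on couplings ≤ ½, β ≡ −1 on couplings ≥ 0.55) has memory profile `(40, θ)`
# on every box AND the asymptotically free box solution `t(m) = (4 + m)^{−1∕2}` from the pin ½, yet NO box solution in ]0, 2] from the pin 1 (`1∕h(1)² = 1 + β(h(1))` has no
# root: `> 2` needed below 0.55, `= 0` forced above) — the binder list of part 13 with (S) deleted is FALSE: asymptotic freedom near zero does not propagate to large pins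
# through a sign change of the functional.  (W3) `B ≡ 0` has profile `(0, θ)` and the box solution `h ≡ e` from every pin, which is NOT asymptotically free: a memory
# profile alone does not produce the reference.  [folklore] kernel witnesses, abstract functionals (β-flow team, prover 1, unit `b2b-balaban-beta-bflow-p1`, gen 37;
# ROW AP-I·Uc × NODE U2)

HONEST FRAMING (page 1 of everything the β sub-cell writes): discharging `BetaPertH` makes Bałaban's UV stability UNCONDITIONAL — a
real constructive-QFT result; it is NOT the continuum limit and NOT the Clay problem.  HONEST DEPENDENCY (cell reorg 2026-08-19,
verbatim): «continuum YM on T⁴ ⇐ BetaPertH ∧ nine spine estimates (0/9 proved); BetaPertH ⇐ (D1) ∧ (D4) ∧ CAP+tail; G-an2-4 gates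
asym, D1 and NE2/3/4.»  THIS MODULE DISCHARGES NOTHING: three TOY functionals on node U2's HYPOTHESIS SHAPES `T4BetaStationary.{SeqBox, MemoryProfile}`,
`T4BetaFlowWellPosed.{MemFlow, drive}` ([folklore]; kernel-checked, no placeholders).  They say NOTHING about Bałaban's β ([I] = T. Bałaban, Commun. Math. Phys. **109**
(1987) [Balaban1987RG1], whose β is positive at small coupling by (0.31), Theorem 2 p. 259, stated without proof): they only certify that the two hypotheses of parts
12–13 are used.

WHAT THIS FILE PROVES (0 sorry, 0 def): `memoryProfile_const`, **`no_memFlow_const_neg`**, **`exists_memFlow_false_without_reference`** (W1); `abs_clamp_sub_clamp_le`,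
`memoryProfile_signChange`, `memFlow_signChange_ref`, **`no_memFlow_signChange_one`**, **`exists_memFlow_false_without_smallness`** (W2); `memFlow_const_of_zero`,
**`exists_profile_without_af_solution`** (W3).  NOT CLAIMED: anything about Bałaban's β; sharp thresholds; `BetaPertH`; Clay.
-/

namespace Summit.QuantumFields.BalabanUV.Beta.EriceFlowEnclosureB12AsPrintedHistoryContagionShiftFlowPicardWitness

open Finset Filter Topology
open Literature.MathematicalPhysics.QuantumFieldTheory.Balaban1983to89
open Literature.MathematicalPhysics.QuantumFieldTheory.Balaban1983to89.T4CouplingMatching (prof sprof sprof_pos sprof_sq prof_pos sprof_zero)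
open Literature.MathematicalPhysics.QuantumFieldTheory.Balaban1983to89.T4BetaStationary (SeqBox MemoryProfile summable_profile)
open Literature.MathematicalPhysics.QuantumFieldTheory.Balaban1983to89.T4BetaFlowWellPosed (MemFlow drive invSq_eq_of_memFlow one_div_sq_one_div_sqrt)
open Summit.QuantumFields.BalabanUV.Beta.EriceFlowEnclosureB12AsPrintedHistoryContagion (sprof_le_sprof)

noncomputable section

/-! ## (W1) Without a reference: a functional with memory profile and no box solution from any pin -/

/-- A constant functional has memory profile `(C_m, θ)` for every `C_m ≥ 0`, `θ ≥ 0`, on every box. [folklore] -/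
theorem memoryProfile_const (c : ℝ) {Cm θ γ : ℝ} (hCm : 0 ≤ Cm) (hθ0 : 0 ≤ θ) : MemoryProfile Cm θ γ (fun _ => c) := by
  intro u u' _ _
  rw [sub_self, abs_zero]
  exact mul_nonneg hCm (tsum_nonneg fun j => mul_nonneg (pow_nonneg hθ0 j) (abs_nonneg _))

/-- **`B ≡ −1` HAS NO BOX SOLUTION FROM ANY PIN**: along a solution `1∕h(m)² = 1∕e² − m`, which is negative for m > 1∕e². [folklore] -/
theorem no_memFlow_const_neg (e γ : ℝ) : ¬ ∃ h : ℕ → ℝ, SeqBox γ h ∧ MemFlow (fun _ => (-1 : ℝ)) e h := by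
  rintro ⟨h, hhs, hhf⟩
  obtain ⟨m, hm⟩ := exists_nat_gt (1 / e ^ 2)
  have h1 := invSq_eq_of_memFlow hhf m
  have hd : drive (fun _ => (-1 : ℝ)) h m = -(m : ℝ) := by
    unfold T4BetaFlowWellPosed.drive; simp
  rw [hd] at h1
  have hpos : 0 < 1 / (h m) ^ 2 := by have := (hhs m).1; positivity
  linarith

/-- **THE REFERENCE CANNOT BE DROPPED from part 13's `exists_memFlow_of_reference` ∕ `memFlow_solution_of_reference`**: the binder list with the reference solution
(`SeqBox γ t`, `MemFlow B g* t`, its AF profile) DELETED — everything else kept (memory profile, 0 ≤ θ < 1, β* > 0, `0 < e`, `2e ≤ γ`, the three smallness conditions,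
even with g* retained as a free parameter) — is FALSE: `B ≡ −1`, C_m = 0, θ = 0, γ = 2, β* = 1, g* = 2, e = 1. [folklore] -/
theorem exists_memFlow_false_without_reference :
    ¬ (∀ (B : (ℕ → ℝ) → ℝ) (Cm θ γ bs gs e : ℝ), MemoryProfile Cm θ γ B → 0 ≤ Cm → 0 ≤ θ → θ < 1 → 0 < bs → 0 < e → 2 * e ≤ γ →
        4 * Cm * e ≤ bs * (1 - θ) → e ^ 2 * (1 / gs ^ 2 + Cm * γ / (1 - θ) ^ 2 + (2 * Cm / ((1 - θ) * bs)) ^ 2) ≤ 3 / 4 →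
        64 * Cm * e ^ 3 ≤ (1 - θ) ^ 2 → ∃ h : ℕ → ℝ, SeqBox γ h ∧ MemFlow B e h) := by
  intro H
  have h := H (fun _ => (-1 : ℝ)) 0 0 2 1 2 1 (memoryProfile_const (-1) le_rfl le_rfl) le_rfl le_rfl one_pos one_pos one_pos
    (by norm_num) (by norm_num) (by norm_num) (by norm_num)
  exact no_memFlow_const_neg 1 2 h

/-! ## (W2) Without smallness of the pin: an AF reference near zero, no box solution from the pin 1 -/

/-- The clamp `x ↦ max (min x 1) 0` is 1-Lipschitz. [folklore] -/
theorem abs_clamp_sub_clamp_le (a b : ℝ) : |max (min a 1) 0 - max (min b 1) 0| ≤ |a - b| := by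
  calc |max (min a 1) 0 - max (min b 1) 0| ≤ |min a 1 - min b 1| := abs_max_sub_max_le_abs _ _ _
    _ ≤ max |a - b| |(1 : ℝ) - 1| := abs_min_sub_min_le_max _ _ _ _
    _ = |a - b| := by rw [sub_self, abs_zero]; exact max_eq_left (abs_nonneg _)

/-- THE SIGN-CHANGING MARKOV FUNCTIONAL `B u = 1 − 2·clamp(20(u₀ − ½))` has memory profile `(40, θ)` on every box, for every `0 ≤ θ < 1`. [folklore] -/
theorem memoryProfile_signChange {θ γ : ℝ} (hθ0 : 0 ≤ θ) (hθ1 : θ < 1) :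
    MemoryProfile 40 θ γ (fun u => 1 - 2 * max (min (20 * (u 0 - 1 / 2)) 1) 0) := by
  intro u u' hu hu'
  show |(1 - 2 * max (min (20 * (u 0 - 1 / 2)) 1) 0) - (1 - 2 * max (min (20 * (u' 0 - 1 / 2)) 1) 0)| ≤ 40 * ∑' j, θ ^ j * |u j - u' j|
  have hs := summable_profile hθ0 hθ1 hu hu'
  have h0 : θ ^ 0 * |u 0 - u' 0| ≤ ∑' j, θ ^ j * |u j - u' j| :=
    hs.le_tsum 0 (fun j _ => mul_nonneg (pow_nonneg hθ0 j) (abs_nonneg _))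
  rw [pow_zero, one_mul] at h0
  have hc : |max (min (20 * (u 0 - 1 / 2)) 1) 0 - max (min (20 * (u' 0 - 1 / 2)) 1) 0| ≤ 20 * |u 0 - u' 0| := by
    have h := abs_clamp_sub_clamp_le (20 * (u 0 - 1 / 2)) (20 * (u' 0 - 1 / 2))
    have e2 : 20 * (u 0 - 1 / 2) - 20 * (u' 0 - 1 / 2) = 20 * (u 0 - u' 0) := by ring
    rw [e2, abs_mul, abs_of_pos (by norm_num : (0 : ℝ) < 20)] at h
    exact h
  have e1 : (1 - 2 * max (min (20 * (u 0 - 1 / 2)) 1) 0) - (1 - 2 * max (min (20 * (u' 0 - 1 / 2)) 1) 0)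
      = -2 * (max (min (20 * (u 0 - 1 / 2)) 1) 0 - max (min (20 * (u' 0 - 1 / 2)) 1) 0) := by ring
  rw [e1, abs_mul, show |(-2 : ℝ)| = 2 by norm_num]
  linarith

/-- Below ½ the clamp vanishes: β = 1 there. [folklore] -/
theorem signChange_of_le_half {x : ℝ} (hx : x ≤ 1 / 2) : 1 - 2 * max (min (20 * (x - 1 / 2)) 1) 0 = 1 := by
  have h1 : min (20 * (x - 1 / 2)) 1 ≤ 0 := (min_le_left _ _).trans (by linarith)
  rw [max_eq_right h1]; ring

/-- Above 0.55 the clamp saturates: β = −1 there. [folklore] -/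
theorem signChange_of_ge {x : ℝ} (hx : 11 / 20 ≤ x) : 1 - 2 * max (min (20 * (x - 1 / 2)) 1) 0 = -1 := by
  have h1 : min (20 * (x - 1 / 2)) 1 = 1 := min_eq_right (by linarith)
  rw [h1, max_eq_left zero_le_one]; ring

/-- β ≤ 1 everywhere. [folklore] -/
theorem signChange_le_one (x : ℝ) : 1 - 2 * max (min (20 * (x - 1 / 2)) 1) 0 ≤ 1 := by
  linarith [le_max_right (min (20 * (x - 1 / 2)) 1) 0]

/-- **THE ASYMPTOTICALLY FREE REFERENCE** of the sign-changing functional: `t(m) = (4 + m)^{−1∕2} = 1∕sprof ½ 1 m` is a box solution in ]0, 2] from the pin ½ with the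
profile `1∕(½)² + 1·m ≤ 1∕t(m)²` (equality) — it never leaves the region β ≡ 1. [folklore] -/
theorem memFlow_signChange_ref :
    SeqBox 2 (fun m => 1 / sprof (1 / 2) 1 m) ∧ MemFlow (fun u => 1 - 2 * max (min (20 * (u 0 - 1 / 2)) 1) 0) (1 / 2) (fun m => 1 / sprof (1 / 2) 1 m) ∧
      ∀ m : ℕ, 1 / (1 / 2 : ℝ) ^ 2 + 1 * (m : ℝ) ≤ 1 / ((fun m => 1 / sprof (1 / 2) 1 m) m) ^ 2 := by
  have hh : (0 : ℝ) < 1 / 2 := by norm_num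
  have hp0 := sprof_pos hh zero_le_one
  have hchart : ∀ m : ℕ, 1 / (1 / sprof (1 / 2 : ℝ) 1 m) ^ 2 = 1 / (1 / 2 : ℝ) ^ 2 + 1 * (m : ℝ) := fun m => by
    show 1 / (1 / Real.sqrt (prof (1 / 2) 1 m)) ^ 2 = 1 / (1 / 2 : ℝ) ^ 2 + 1 * (m : ℝ)
    rw [one_div_sq_one_div_sqrt (prof_pos hh zero_le_one m)]
    rfl
  have hle : ∀ m : ℕ, 1 / sprof (1 / 2 : ℝ) 1 m ≤ 1 / 2 := fun m => by
    calc 1 / sprof (1 / 2 : ℝ) 1 m ≤ 1 / sprof (1 / 2 : ℝ) 1 0 := one_div_le_one_div_of_le (hp0 0) (sprof_le_sprof zero_le_one (Nat.zero_le m))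
      _ = 1 / 2 := by rw [sprof_zero hh, one_div_one_div]
  refine ⟨fun m => ⟨one_div_pos.mpr (hp0 m), (hle m).trans (by norm_num)⟩, ⟨?_, fun m => ?_⟩, fun m => (hchart m).symm.le⟩
  · show 1 / sprof (1 / 2 : ℝ) 1 0 = 1 / 2
    rw [sprof_zero hh, one_div_one_div]
  · show 1 / (1 / sprof (1 / 2 : ℝ) 1 (m + 1)) ^ 2 = 1 / (1 / sprof (1 / 2 : ℝ) 1 m) ^ 2 + (1 - 2 * max (min (20 * (1 / sprof (1 / 2 : ℝ) 1 (m + 1 + 0) - 1 / 2)) 1) 0)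
    rw [add_zero, signChange_of_le_half (hle (m + 1)), hchart, hchart]
    push_cast
    ring

/-- **NO BOX SOLUTION IN ]0, 2] FROM THE PIN 1**: the first step `1∕h(1)² = 1 + β(h(1))` has no root — below 0.55 the left side exceeds 2 ≥ right side, above it the right side
is 0. [folklore] -/
theorem no_memFlow_signChange_one :
    ¬ ∃ h : ℕ → ℝ, SeqBox 2 h ∧ MemFlow (fun u => 1 - 2 * max (min (20 * (u 0 - 1 / 2)) 1) 0) 1 h := by
  rintro ⟨h, hhs, hhf⟩
  have h1 := hhf.2 0
  rw [zero_add, hhf.1] at h1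
  simp only [add_zero] at h1
  -- h1 : 1 / h 1 ^ 2 = 1 / 1 ^ 2 + (1 - 2 * clamp (h 1))
  have hx := (hhs 1).1
  by_cases hc : 11 / 20 ≤ h 1
  · rw [signChange_of_ge hc] at h1
    have : 0 < 1 / (h 1) ^ 2 := by positivity
    norm_num at h1
    linarith
  · have hc' : h 1 < 11 / 20 := lt_of_not_ge hc
    have hsq : (h 1) ^ 2 < (11 / 20) ^ 2 := by nlinarith
    have hgt : 1 / ((11 : ℝ) / 20) ^ 2 < 1 / (h 1) ^ 2 := one_div_lt_one_div_of_lt (pow_pos hx 2) hsq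
    have hle := signChange_le_one (h 1)
    norm_num at hgt h1
    linarith

/-- **THE SMALLNESS OF THE PIN CANNOT BE DROPPED from part 13's `exists_memFlow_of_reference`**: the binder list with the three smallness conditions (`4C_m e ≤ β*(1−θ)`,
`e²Q ≤ 3∕4`, `64C_m e³ ≤ (1−θ)²`) DELETED — everything else kept (memory profile with 0 ≤ θ < 1, C_m ≥ 0; the asymptotically free reference; `0 < e`, `2e ≤ γ`; a box
start ≤ 2e) — is FALSE: the sign-changing functional on ]0, 2], reference from ½, pin 1. [folklore] -/
theorem exists_memFlow_false_without_smallness :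
    ¬ (∀ (B : (ℕ → ℝ) → ℝ) (Cm θ γ bs ta gs e : ℝ) (t u : ℕ → ℝ), MemoryProfile Cm θ γ B → 0 ≤ Cm → 0 ≤ θ → θ < 1 → 0 < bs → 0 < ta →
        SeqBox γ t → MemFlow B gs t → (∀ m : ℕ, 1 / ta ^ 2 + bs * (m : ℝ) ≤ 1 / (t m) ^ 2) → 0 < e → 2 * e ≤ γ → SeqBox γ u → (∀ q, u q ≤ 2 * e) →
        ∃ h : ℕ → ℝ, SeqBox γ h ∧ MemFlow B e h) := by
  intro H
  obtain ⟨hts, htf, hprof⟩ := memFlow_signChange_ref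
  have h := H (fun u => 1 - 2 * max (min (20 * (u 0 - 1 / 2)) 1) 0) 40 0 2 1 (1 / 2) (1 / 2) 1 (fun m => 1 / sprof (1 / 2) 1 m) (fun _ => 1)
    (memoryProfile_signChange le_rfl zero_lt_one) (by norm_num) le_rfl zero_lt_one one_pos (by norm_num) hts htf hprof one_pos (by norm_num)
    (fun _ => ⟨one_pos, by norm_num⟩) (fun _ => by norm_num)
  exact no_memFlow_signChange_one h

/-! ## (W3) A memory profile alone produces no asymptotically free solution -/

/-- `B ≡ 0`: the constant history is a box solution from every pin in the box. [folklore] -/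
theorem memFlow_const_of_zero {e γ : ℝ} (he : 0 < e) (heγ : e ≤ γ) :
    SeqBox γ (fun _ => e) ∧ MemFlow (fun _ => (0 : ℝ)) e (fun _ => e) :=
  ⟨fun _ => ⟨he, heγ⟩, rfl, fun _ => by simp⟩

/-- **A MEMORY PROFILE DOES NOT PRODUCE THE REFERENCE**: `B ≡ 0` has memory profile `(0, θ)` on every box and a box solution from every pin (`h ≡ e`, unique by node U2's
`memFlow_unique_of_markov`, not needed here), but NO box solution of it carries an asymptotically free profile `1∕t_a² + β*·m ≤ 1∕t(m)²` with β* > 0 (the right side is the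
constant `1∕g*²`).  So part 13's reference hypothesis is a genuine restriction on B, not a consequence of the profile. [folklore] -/
theorem exists_profile_without_af_solution :
    ∃ B : (ℕ → ℝ) → ℝ, (∀ θ γ : ℝ, 0 ≤ θ → MemoryProfile 0 θ γ B) ∧ (∀ e γ : ℝ, 0 < e → e ≤ γ → ∃ h, SeqBox γ h ∧ MemFlow B e h) ∧
      ∀ (γ bs ta gs : ℝ) (t : ℕ → ℝ), 0 < bs → SeqBox γ t → MemFlow B gs t → ¬ ∀ m : ℕ, 1 / ta ^ 2 + bs * (m : ℝ) ≤ 1 / (t m) ^ 2 := by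
  refine ⟨fun _ => 0, fun θ γ hθ0 => memoryProfile_const 0 le_rfl hθ0, fun e γ he heγ => ⟨fun _ => e, memFlow_const_of_zero he heγ⟩, ?_⟩
  intro γ bs ta gs t hbs hts htf hprof
  have hconst : ∀ m, 1 / (t m) ^ 2 = 1 / gs ^ 2 := fun m => by
    have h1 := invSq_eq_of_memFlow htf m
    have hd : drive (fun _ => (0 : ℝ)) t m = 0 := by unfold T4BetaFlowWellPosed.drive; simp
    rw [h1, hd, add_zero]
  obtain ⟨m, hm⟩ := exists_nat_gt (1 / gs ^ 2 / bs)
  have h2 := hprof m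
  rw [hconst] at h2
  have hta : 0 ≤ 1 / ta ^ 2 := by positivity
  rw [div_lt_iff₀ hbs] at hm
  linarith

end

end Summit.QuantumFields.BalabanUV.Beta.EriceFlowEnclosureB12AsPrintedHistoryContagionShiftFlowPicardWitness
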